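import Mathlib.Combinatorics.Enumerative.DoubleCounting
import Literature.Combinatorics.Additive.TripleProductProperty
import Literature.Computability.AlgebraicComplexity.TPPGroupExtension

/-!
# ω-census, family (b3): no TPP triple with two `3`-sets beats `Σ d³` when the commutators are one central involution

HONEST FRAMING (pub-omega census; verbatim): lottery ticket; floor = certified bounds/negative ranges.
Census BOOKKEEPING: a STRUCTURAL law (no tables, no kernel enumeration) containing the machine box constants of `D4Box.lean` /
`Q8Box.lean` (`α_{D₄} = α_{Q₈} = 12`) as instances.  A certified NEGATIVE RANGE for single TPP triples; nothing here is progress on `ω`.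

STATEMENT.  `SmallComm z`: (H1) `z ≠ 1`, `z² = 1`; (H2) every commutator is `1` or `z`; (H3) an element commuting with two non-commuting
elements is central.  Every group whose centre has index `4` satisfies it (`G/Z(G) ≅ C₂²`, `G' = {1, z}`: `D₄`, `Q₈`, the six groups of
order `16` with `|G'| = 2`, `M₃₂`, `D₄ ∘ C₈`, …, and `Q × A` for such `Q` and abelian `A` — `SmallComm.prod`; `D₄`, `Q₈` are checked here by
`decide`).  THEOREM `SmallComm.two_mul_volume_le`: every TPP triple `(S, T, U)` of such a finite `G` with `|T|, |U| ≤ 3` has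
`2·|S||T||U| ≤ 3·|G|` (`= 2·Σ_χ χ(1)³` when `[G : Z(G)] = 4`); hence no `⟨N, m, p⟩` with `m, p ≤ 3`, `3|G| < 2Nmp` — for `⟨N, 3, 3⟩`
none when `|G| < 6N`, one notch below Neumann's `5N ≤ |G|` (2011, Obs. 3.1) valid for all groups.
PROOF (pre-registered as the MECHANISM of census prereg P-027, then confirmed by two exact engines on 13 groups of orders 16, 32).
Count each triple `P = (s, t, u)` at `stu` and at `stu·z`.  Two distinct triples counted at the same `g` have TPP word
`E(P, P') = s s'⁻¹ (t t'⁻¹) (u u'⁻¹) ≠ 1` and `≡ stu (s't'u')⁻¹ (mod z)` (H2, two transpositions: `key_mul_inv_eq`), so `E(P, P') = z` in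
both orders (`E_eq_of_fibre`).  FIBRE LEMMA (`fibre_card_le_three`): at most `3` cells with `t` in a `3`-set and `u` in a `3`-set have
pairwise words `z` — `pair`: both words `z` force `[t t'⁻¹, u u'⁻¹] = 1` and `s s'⁻¹ = z (u' u⁻¹)(t' t⁻¹)`; composing around three cells
gives `z = 1` for two cells over one position (`same_pos`), for two cells sharing `t` and a third sharing `u` with one of them (`ell`),
and, through (H3), for two cells sharing `t` plus two sharing `u` (`shape`); four cells always contain one of these patterns
(`no_four_row`).  Then `2|S||T||U| = Σ_g #(fibre g) ≤ 3|G|`.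
Elementary new mathematics of the cell (pub-omega stpp-1 gen 12), not a published statement: it lives under `Summits/`, not `Literature/`.
-/

open Finset
open Literature.Combinatorics.Additive

namespace Summit.MatrixMultiplication.OmegaCensus.CentreIndexFour

variable {G : Type*} [Group G]

/-- The hypothesis package `SmallComm z`: `z` is a non-trivial involution, every commutator is `1` or `z`, and an element commuting
with two non-commuting elements is central.  (Satisfied by every group with centre of index `4`, `z` the non-trivial commutator.) [folklore] -/
def SmallComm (z : G) : Prop :=
  z ≠ 1 ∧ z * z = 1 ∧ (∀ a b : G, a * b = b * a ∨ a * b = b * a * z) ∧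
    ∀ a b t : G, a * b ≠ b * a → a * t = t * a → b * t = t * b → ∀ g : G, g * t = t * g

/-- The TPP word of two cells `P = (s, t, u)`, `P' = (s', t', u')`: `s s'⁻¹ (t t'⁻¹) (u u'⁻¹)` (bracketing of `TripleProductProperty`). [folklore] -/
def E (P P' : G × G × G) : G := P.1 * P'.1⁻¹ * (P.2.1 * P'.2.1⁻¹) * (P.2.2 * P'.2.2⁻¹)

/-- The product `s t u` of a cell `(s, t, u)` (the fibre map). [folklore] -/
def key (P : G × G × G) : G := P.1 * P.2.1 * P.2.2

/-! ## Two general lemmas -/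

/-- Four values in a `3`-set: if three are distinct, the fourth is one of them. [folklore] -/
theorem eq_or_of_card_le_three {α : Type*} [DecidableEq α] {U : Finset α} (hU : #U ≤ 3) {a b c d : α} (ha : a ∈ U) (hb : b ∈ U)
    (hc : c ∈ U) (hd : d ∈ U) (hab : a ≠ b) (hac : a ≠ c) (hbc : b ≠ c) : d = a ∨ d = b ∨ d = c := by
  by_contra! hne
  obtain ⟨hda, hdb, hdc⟩ := hne
  have hsub : ({a, b, c, d} : Finset α) ⊆ U := by
    intro x hx
    simp only [mem_insert, mem_singleton] at hx
    rcases hx with rfl | rfl | rfl | rfl <;> assumption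
  have hcard : #({a, b, c, d} : Finset α) = 4 := by
    rw [card_insert_of_notMem, card_insert_of_notMem, card_insert_of_notMem, card_singleton]
    · simpa using hdc.symm
    · simp only [mem_insert, mem_singleton, not_or]; exact ⟨hbc, hdb.symm⟩
    · simp only [mem_insert, mem_singleton, not_or]; exact ⟨hab, hac, hda.symm⟩
  have := card_le_card hsub
  omega

/-- Inverses of central elements are central. [folklore] -/
theorem comm_inv' {t : G} (ht : ∀ g : G, g * t = t * g) (g : G) : g * t⁻¹ = t⁻¹ * g := by
  calc g * t⁻¹ = t⁻¹ * (t * g) * t⁻¹ := by group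
    _ = t⁻¹ * (g * t) * t⁻¹ := by rw [ht g]
    _ = t⁻¹ * g := by group


namespace SmallComm

variable {z : G} (h : SmallComm z)
include h

/-! ## Algebra in a `SmallComm` group -/

/-- `z ≠ 1`. [folklore] -/ theorem ne_one : z ≠ 1 := h.1
/-- `z² = 1`. [folklore] -/ theorem sq : z * z = 1 := h.2.1
/-- Every commutator is `1` or `z`. [folklore] -/ theorem comm_or (a b : G) : a * b = b * a ∨ a * b = b * a * z := h.2.2.1 a b
/-- The centraliser of a non-commuting pair is central. [folklore] -/
theorem central_of (a b t : G) (hab : a * b ≠ b * a) (ha : a * t = t * a) (hb : b * t = t * b) (g : G) : g * t = t * g :=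
  h.2.2.2 a b t hab ha hb g

/-- `z` is central. [folklore] -/
theorem central (g : G) : g * z = z * g := by
  rcases h.comm_or g z with e | e
  · exact e
  · have e' : g = z * g := mul_right_cancel e
    exact absurd (by calc z = z * g * g⁻¹ := by group
                       _ = g * g⁻¹ := by rw [← e']
                       _ = 1 := by group) h.ne_one

/-- `z⁻¹ = z`. [folklore] -/
theorem inv_eq : z⁻¹ = z := inv_eq_of_mul_eq_one_right h.sq

/-- `z·z ≠ z`. [folklore] -/
theorem zz_ne : z * z ≠ z := fun e => h.ne_one (by
  calc z = z * z * z⁻¹ := by group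
    _ = 1 := by rw [e]; group)

/-- **Pair lemma.** If both ordered words of the cells `(x, y, w)`, `(x', y', w')` equal `z`, then `y y'⁻¹` and `w w'⁻¹` commute and
`x x'⁻¹ = z · (w' w⁻¹)(y' y⁻¹)`. [folklore] -/
theorem pair {x x' y y' w w' : G} (h1 : x * x'⁻¹ * (y * y'⁻¹) * (w * w'⁻¹) = z)
    (h2 : x' * x⁻¹ * (y' * y⁻¹) * (w' * w⁻¹) = z) :
    y * y'⁻¹ * (w * w'⁻¹) = w * w'⁻¹ * (y * y'⁻¹) ∧ x * x'⁻¹ = z * (w' * w⁻¹ * (y' * y⁻¹)) := by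
  have e1 : x * x'⁻¹ = z * (w' * w⁻¹ * (y' * y⁻¹)) := by
    calc x * x'⁻¹ = x * x'⁻¹ * (y * y'⁻¹) * (w * w'⁻¹) * (w' * w⁻¹ * (y' * y⁻¹)) := by group
      _ = z * (w' * w⁻¹ * (y' * y⁻¹)) := by rw [h1]
  refine ⟨?_, e1⟩
  have e2 : x' * x⁻¹ = y * y'⁻¹ * (w * w'⁻¹) * z⁻¹ := by
    calc x' * x⁻¹ = (x * x'⁻¹)⁻¹ := by group
      _ = (z * (w' * w⁻¹ * (y' * y⁻¹)))⁻¹ := by rw [e1]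
      _ = y * y'⁻¹ * (w * w'⁻¹) * z⁻¹ := by group
  rw [e2, h.inv_eq, h.central (y * y'⁻¹ * (w * w'⁻¹))] at h2
  have e3 : y * y'⁻¹ * (w * w'⁻¹) * (y' * y⁻¹) * (w' * w⁻¹) = 1 := by
    calc y * y'⁻¹ * (w * w'⁻¹) * (y' * y⁻¹) * (w' * w⁻¹)
        = z⁻¹ * (z * (y * y'⁻¹ * (w * w'⁻¹)) * (y' * y⁻¹) * (w' * w⁻¹)) := by group
      _ = z⁻¹ * z := by rw [h2]
      _ = 1 := by group
  calc y * y'⁻¹ * (w * w'⁻¹)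
      = y * y'⁻¹ * (w * w'⁻¹) * (y' * y⁻¹) * (w' * w⁻¹) * (w * w'⁻¹ * (y * y'⁻¹)) := by group
    _ = w * w'⁻¹ * (y * y'⁻¹) := by rw [e3, one_mul]

/-- **Same position.** Two cells `(x₀, y, w)`, `(x₁, y, w)` over one position and any third cell cannot have all words `z`. [folklore] -/
theorem same_pos {x₀ x₁ x₂ y y'' w w'' : G} (h01 : x₀ * x₁⁻¹ * (y * y⁻¹) * (w * w⁻¹) = z)
    (h02 : x₀ * x₂⁻¹ * (y * y''⁻¹) * (w * w''⁻¹) = z) (h12 : x₁ * x₂⁻¹ * (y * y''⁻¹) * (w * w''⁻¹) = z) : False := by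
  have e : x₀ * x₁⁻¹ = z := by simpa using h01
  refine h.zz_ne ?_
  calc z * z = x₀ * x₁⁻¹ * (x₁ * x₂⁻¹ * (y * y''⁻¹) * (w * w''⁻¹)) := by rw [e, h12]
    _ = x₀ * x₂⁻¹ * (y * y''⁻¹) * (w * w''⁻¹) := by group
    _ = z := h02

/-- **L-tromino.** Cells `(xa, y, w)`, `(xb, y, w')` in one row and `(xc, y'', w)` in the column of the first cannot have all words `z`. [folklore] -/
theorem ell {xa xb xc y y'' w w' : G} (hab : xa * xb⁻¹ * (y * y⁻¹) * (w * w'⁻¹) = z)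
    (hbc : xb * xc⁻¹ * (y * y''⁻¹) * (w' * w⁻¹) = z) (hac : xa * xc⁻¹ * (y * y''⁻¹) * (w * w⁻¹) = z) : False := by
  have e1 : xa * xb⁻¹ = z * (w' * w⁻¹) := by
    calc xa * xb⁻¹ = xa * xb⁻¹ * (y * y⁻¹) * (w * w'⁻¹) * (w' * w⁻¹) := by group
      _ = z * (w' * w⁻¹) := by rw [hab]
  have e2 : xb * xc⁻¹ = z * (w * w'⁻¹ * (y'' * y⁻¹)) := by
    calc xb * xc⁻¹ = xb * xc⁻¹ * (y * y''⁻¹) * (w' * w⁻¹) * (w * w'⁻¹ * (y'' * y⁻¹)) := by group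
      _ = z * (w * w'⁻¹ * (y'' * y⁻¹)) := by rw [hbc]
  have e3 : xa * xc⁻¹ * (y * y''⁻¹) * (w * w⁻¹) = z * z := by
    calc xa * xc⁻¹ * (y * y''⁻¹) * (w * w⁻¹) = xa * xb⁻¹ * (xb * xc⁻¹) * (y * y''⁻¹) := by group
      _ = z * (w' * w⁻¹) * (z * (w * w'⁻¹ * (y'' * y⁻¹))) * (y * y''⁻¹) := by rw [e1, e2]
      _ = z * (w' * w⁻¹ * z) * (w * w'⁻¹ * (y'' * y⁻¹)) * (y * y''⁻¹) := by group
      _ = z * (z * (w' * w⁻¹)) * (w * w'⁻¹ * (y'' * y⁻¹)) * (y * y''⁻¹) := by rw [h.central (w' * w⁻¹)]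
      _ = z * z := by group
  rw [e3] at hac
  exact h.zz_ne hac

/-- **Two in a row and two in a column.** Cells `(x₀, y, w₀)`, `(x₁, y, w₁)`, `(x₂, y', w₂)`, `(x₃, y'', w₂)` cannot have all words `z`
(the words used are listed as hypotheses).  This is where (H3) enters. [folklore] -/
theorem shape {x₀ x₁ x₂ x₃ y y' y'' w₀ w₁ w₂ : G}
    (h01 : x₀ * x₁⁻¹ * (y * y⁻¹) * (w₀ * w₁⁻¹) = z) (h12 : x₁ * x₂⁻¹ * (y * y'⁻¹) * (w₁ * w₂⁻¹) = z)
    (h02 : x₀ * x₂⁻¹ * (y * y'⁻¹) * (w₀ * w₂⁻¹) = z) (h20 : x₂ * x₀⁻¹ * (y' * y⁻¹) * (w₂ * w₀⁻¹) = z)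
    (h23 : x₂ * x₃⁻¹ * (y' * y''⁻¹) * (w₂ * w₂⁻¹) = z)
    (h03 : x₀ * x₃⁻¹ * (y * y''⁻¹) * (w₀ * w₂⁻¹) = z) (h30 : x₃ * x₀⁻¹ * (y'' * y⁻¹) * (w₂ * w₀⁻¹) = z) : False := by
  obtain ⟨c02, e02⟩ := h.pair h02 h20
  obtain ⟨c03, e03⟩ := h.pair h03 h30
  have e01 : x₀ * x₁⁻¹ = z * (w₁ * w₀⁻¹) := by
    calc x₀ * x₁⁻¹ = x₀ * x₁⁻¹ * (y * y⁻¹) * (w₀ * w₁⁻¹) * (w₁ * w₀⁻¹) := by group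
      _ = z * (w₁ * w₀⁻¹) := by rw [h01]
  have e12 : x₁ * x₂⁻¹ = z * (w₂ * w₁⁻¹ * (y' * y⁻¹)) := by
    calc x₁ * x₂⁻¹ = x₁ * x₂⁻¹ * (y * y'⁻¹) * (w₁ * w₂⁻¹) * (w₂ * w₁⁻¹ * (y' * y⁻¹)) := by group
      _ = z * (w₂ * w₁⁻¹ * (y' * y⁻¹)) := by rw [h12]
  have e23 : x₂ * x₃⁻¹ = z * (y'' * y'⁻¹) := by
    calc x₂ * x₃⁻¹ = x₂ * x₃⁻¹ * (y' * y''⁻¹) * (w₂ * w₂⁻¹) * (y'' * y'⁻¹) := by group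
      _ = z * (y'' * y'⁻¹) := by rw [h23]
  -- (A) `y y'⁻¹` and `y y''⁻¹` do not commute (triangle 0, 2, 3)
  have nc : y * y'⁻¹ * (y * y''⁻¹) ≠ y * y''⁻¹ * (y * y'⁻¹) := by
    intro hc
    have tri : z * (w₂ * w₀⁻¹ * (y'' * y⁻¹)) = z * (w₂ * w₀⁻¹ * (y' * y⁻¹)) * (z * (y'' * y'⁻¹)) := by
      rw [← e03, ← e02, ← e23]; group
    have t1 : y'' * y⁻¹ = y' * y⁻¹ * z * (y'' * y'⁻¹) := by
      calc y'' * y⁻¹ = (z * (w₂ * w₀⁻¹))⁻¹ * (z * (w₂ * w₀⁻¹ * (y'' * y⁻¹))) := by group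
        _ = (z * (w₂ * w₀⁻¹))⁻¹ * (z * (w₂ * w₀⁻¹ * (y' * y⁻¹)) * (z * (y'' * y'⁻¹))) := by rw [tri]
        _ = y' * y⁻¹ * z * (y'' * y'⁻¹) := by group
    rw [h.central (y' * y⁻¹)] at t1
    have sw : (y * y''⁻¹)⁻¹ * (y * y'⁻¹) = y * y'⁻¹ * (y * y''⁻¹)⁻¹ := by
      calc (y * y''⁻¹)⁻¹ * (y * y'⁻¹) = (y * y''⁻¹)⁻¹ * (y * y'⁻¹ * (y * y''⁻¹)) * (y * y''⁻¹)⁻¹ := by group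
        _ = (y * y''⁻¹)⁻¹ * (y * y''⁻¹ * (y * y'⁻¹)) * (y * y''⁻¹)⁻¹ := by rw [hc]
        _ = y * y'⁻¹ * (y * y''⁻¹)⁻¹ := by group
    have t2 : y' * y⁻¹ * (y'' * y'⁻¹) = y'' * y⁻¹ := by
      calc y' * y⁻¹ * (y'' * y'⁻¹) = (y * y'⁻¹)⁻¹ * ((y * y''⁻¹)⁻¹ * (y * y'⁻¹)) := by group
        _ = (y * y'⁻¹)⁻¹ * (y * y'⁻¹ * (y * y''⁻¹)⁻¹) := by rw [sw]
        _ = y'' * y⁻¹ := by group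
    have t3 : y'' * y⁻¹ = z * (y'' * y⁻¹) := by
      calc y'' * y⁻¹ = z * (y' * y⁻¹) * (y'' * y'⁻¹) := t1
        _ = z * (y' * y⁻¹ * (y'' * y'⁻¹)) := by group
        _ = z * (y'' * y⁻¹) := by rw [t2]
    exact h.ne_one (by
      calc z = z * (y'' * y⁻¹) * (y'' * y⁻¹)⁻¹ := by group
        _ = y'' * y⁻¹ * (y'' * y⁻¹)⁻¹ := by rw [← t3]
        _ = 1 := by group)
  -- (B) hence `w₀ w₂⁻¹`, which commutes with both, is central (H3); so is `w₂ w₀⁻¹`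
  have tc : ∀ g : G, g * (w₀ * w₂⁻¹) = w₀ * w₂⁻¹ * g := h.central_of _ _ _ nc c02 c03
  have sc : ∀ g : G, g * (w₂ * w₀⁻¹) = w₂ * w₀⁻¹ * g := by
    intro g
    have := comm_inv' tc g
    simpa only [mul_inv_rev, inv_inv] using this
  -- (C) triangle 0, 1, 2 then forces `z = 1`
  have tri : z * (w₂ * w₀⁻¹ * (y' * y⁻¹)) = z * (w₁ * w₀⁻¹) * (z * (w₂ * w₁⁻¹ * (y' * y⁻¹))) := by
    rw [← e02, ← e01, ← e12]; group
  have t4 : w₂ * w₀⁻¹ = w₁ * w₀⁻¹ * z * (w₂ * w₁⁻¹) := by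
    calc w₂ * w₀⁻¹ = z⁻¹ * (z * (w₂ * w₀⁻¹ * (y' * y⁻¹))) * (y' * y⁻¹)⁻¹ := by group
      _ = z⁻¹ * (z * (w₁ * w₀⁻¹) * (z * (w₂ * w₁⁻¹ * (y' * y⁻¹)))) * (y' * y⁻¹)⁻¹ := by rw [tri]
      _ = w₁ * w₀⁻¹ * z * (w₂ * w₁⁻¹) := by group
  rw [h.central (w₁ * w₀⁻¹)] at t4
  have t5 : w₁ * w₀⁻¹ * (w₂ * w₁⁻¹) = w₂ * w₀⁻¹ := by
    calc w₁ * w₀⁻¹ * (w₂ * w₁⁻¹) = w₁ * (w₀⁻¹ * (w₂ * w₀⁻¹) * w₀) * w₁⁻¹ := by group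
      _ = w₁ * (w₂ * w₀⁻¹ * w₀⁻¹ * w₀) * w₁⁻¹ := by rw [sc w₀⁻¹]
      _ = w₁ * (w₂ * w₀⁻¹) * w₁⁻¹ := by group
      _ = w₂ * w₀⁻¹ * w₁ * w₁⁻¹ := by rw [sc w₁]
      _ = w₂ * w₀⁻¹ := by group
  have t6 : w₂ * w₀⁻¹ = z * (w₂ * w₀⁻¹) := by
    calc w₂ * w₀⁻¹ = z * (w₁ * w₀⁻¹) * (w₂ * w₁⁻¹) := t4
      _ = z * (w₁ * w₀⁻¹ * (w₂ * w₁⁻¹)) := by group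
      _ = z * (w₂ * w₀⁻¹) := by rw [t5]
  exact h.ne_one (by
    calc z = z * (w₂ * w₀⁻¹) * (w₂ * w₀⁻¹)⁻¹ := by group
      _ = w₂ * w₀⁻¹ * (w₂ * w₀⁻¹)⁻¹ := by rw [← t6]
      _ = 1 := by group)

/-! ## The fibre lemma: at most three cells with pairwise words `z` -/

/-- Four distinct cells of `J` with second coordinates of the first two equal, third coordinates in a `3`-set and all pairwise words of
`J` equal to `z`: impossible (case analysis onto `same_pos`, `ell`, `shape`). [folklore] -/
theorem no_four_row [DecidableEq G] {U : Finset G} (hU : #U ≤ 3) {J : Finset (G × G × G)} (hJU : ∀ P ∈ J, P.2.2 ∈ U)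
    (hz : ∀ P ∈ J, ∀ P' ∈ J, P ≠ P' → E P P' = z) {P₀ P₁ P₂ P₃ : G × G × G} (m₀ : P₀ ∈ J) (m₁ : P₁ ∈ J) (m₂ : P₂ ∈ J)
    (m₃ : P₃ ∈ J) (d₀₁ : P₀ ≠ P₁) (d₀₂ : P₀ ≠ P₂) (d₀₃ : P₀ ≠ P₃) (d₁₂ : P₁ ≠ P₂) (d₁₃ : P₁ ≠ P₃) (d₂₃ : P₂ ≠ P₃)
    (hrow : P₀.2.1 = P₁.2.1) : False := by
  obtain ⟨x₀, y₀, w₀⟩ := P₀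
  obtain ⟨x₁, y₁, w₁⟩ := P₁
  obtain ⟨x₂, y₂, w₂⟩ := P₂
  obtain ⟨x₃, y₃, w₃⟩ := P₃
  simp only at hrow
  subst hrow
  have u₀ : w₀ ∈ U := hJU _ m₀; have u₁ : w₁ ∈ U := hJU _ m₁; have u₂ : w₂ ∈ U := hJU _ m₂; have u₃ : w₃ ∈ U := hJU _ m₃
  have e01 := hz _ m₀ _ m₁ d₀₁; have e10 := hz _ m₁ _ m₀ d₀₁.symm; have e02 := hz _ m₀ _ m₂ d₀₂
  have e20 := hz _ m₂ _ m₀ d₀₂.symm; have e03 := hz _ m₀ _ m₃ d₀₃; have e30 := hz _ m₃ _ m₀ d₀₃.symm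
  have e12 := hz _ m₁ _ m₂ d₁₂; have e13 := hz _ m₁ _ m₃ d₁₃; have e23 := hz _ m₂ _ m₃ d₂₃
  simp only [E] at e01 e10 e02 e20 e03 e30 e12 e13 e23
  by_cases hw01 : w₀ = w₁
  · subst hw01; exact h.same_pos e01 e02 e12
  by_cases hw20 : w₂ = w₀
  · subst hw20; exact h.ell e01 e12 e02
  by_cases hw21 : w₂ = w₁
  · subst hw21; exact h.ell e10 e02 e12
  rcases eq_or_of_card_le_three hU u₀ u₁ u₂ u₃ hw01 (Ne.symm hw20) (Ne.symm hw21) with e | e | e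
  · subst e; exact h.ell e01 e13 e03
  · subst e; exact h.ell e10 e03 e13
  · subst e; exact h.shape e01 e12 e02 e20 e23 e03 e30

/-- **Fibre lemma.** A set of cells `(x, y, w)` with `y` in a `3`-set `T`, `w` in a `3`-set `U` and all pairwise words equal to `z` has at
most `3` elements. [folklore] -/
theorem fibre_card_le_three [DecidableEq G] {T U : Finset G} (hT : #T ≤ 3) (hU : #U ≤ 3) {J : Finset (G × G × G)}
    (hJT : ∀ P ∈ J, P.2.1 ∈ T) (hJU : ∀ P ∈ J, P.2.2 ∈ U) (hz : ∀ P ∈ J, ∀ P' ∈ J, P ≠ P' → E P P' = z) : #J ≤ 3 := by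
  by_contra! hlt
  -- four distinct cells
  obtain ⟨d, hd⟩ : J.Nonempty := card_pos.1 (by omega)
  have h3 : 2 < #(J.erase d) := by rw [card_erase_of_mem hd]; omega
  obtain ⟨a, b, c, ha', hb', hc', hab, hac, hbc⟩ := two_lt_card_iff.1 h3
  have had : a ≠ d := ne_of_mem_erase ha'; have hbd : b ≠ d := ne_of_mem_erase hb'; have hcd : c ≠ d := ne_of_mem_erase hc'
  have ha := mem_of_mem_erase ha'; have hb := mem_of_mem_erase hb'; have hc := mem_of_mem_erase hc'
  -- two of the four second coordinates coincide
  have N := fun {P₀ P₁ P₂ P₃ : G × G × G} (m₀ : P₀ ∈ J) (m₁ : P₁ ∈ J) (m₂ : P₂ ∈ J) (m₃ : P₃ ∈ J) =>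
    h.no_four_row hU hJU hz m₀ m₁ m₂ m₃
  by_cases eab : a.2.1 = b.2.1
  · exact N ha hb hc hd hab hac had hbc hbd hcd eab
  by_cases eac : a.2.1 = c.2.1
  · exact N ha hc hb hd hac hab had hbc.symm hcd hbd eac
  by_cases ebc : b.2.1 = c.2.1
  · exact N hb hc ha hd hbc hab.symm hbd hac.symm hcd had ebc
  rcases eq_or_of_card_le_three hT (hJT _ ha) (hJT _ hb) (hJT _ hc) (hJT _ hd) eab eac ebc with e | e | e
  · exact N hd ha hb hc had.symm hbd.symm hcd.symm hab hac hbc e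
  · exact N hd hb ha hc hbd.symm had.symm hcd.symm hab.symm hbc hac e
  · exact N hd hc ha hb hcd.symm had.symm hbd.symm hac.symm hbc.symm hab e

/-! ## Words versus the fibre map -/

/-- `key P · (key P')⁻¹ = E(P, P') · ζ` with `ζ ∈ {1, z}` (two transpositions, (H2)). [folklore] -/
theorem key_mul_inv_eq (P P' : G × G × G) : ∃ ζ : G, (ζ = 1 ∨ ζ = z) ∧ key P * (key P')⁻¹ = E P P' * ζ := by
  obtain ⟨x, y, w⟩ := P
  obtain ⟨x', y', w'⟩ := P'
  simp only [key, E]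
  have s1 : x * y * w * (x' * y' * w')⁻¹ = x * (y * (w * w'⁻¹ * y'⁻¹) * x'⁻¹) := by group
  rcases h.comm_or (y * (w * w'⁻¹ * y'⁻¹)) x'⁻¹ with e1 | e1 <;> rcases h.comm_or (w * w'⁻¹) y'⁻¹ with e2 | e2
  · exact ⟨1, Or.inl rfl, by rw [s1, e1, e2]; group⟩
  · exact ⟨z, Or.inr rfl, by rw [s1, e1, e2]; group⟩
  · exact ⟨z, Or.inr rfl, by rw [s1, e1, e2]; group⟩
  · refine ⟨1, Or.inl rfl, ?_⟩
    have e3 : x * (x'⁻¹ * (y * (y'⁻¹ * (w * w'⁻¹) * z)) * z) = x * x'⁻¹ * (y * y'⁻¹) * (w * w'⁻¹) * (z * z) := by group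
    rw [s1, e1, e2, e3, h.sq]

/-- In a fibre `{g, g z}` of the fibre map, two distinct cells of a TPP box have word `z`. [folklore] -/
theorem E_eq_of_fibre {S T U : Finset G} (htpp : TripleProductProperty S T U) {g : G} {P P' : G × G × G}
    (hP : P ∈ S ×ˢ (T ×ˢ U)) (hP' : P' ∈ S ×ˢ (T ×ˢ U)) (hne : P ≠ P')
    (hr : key P = g ∨ key P * z = g) (hr' : key P' = g ∨ key P' * z = g) : E P P' = z := by
  -- the word is not `1` (TPP)
  have hE1 : E P P' ≠ 1 := by
    obtain ⟨x, y, w⟩ := P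
    obtain ⟨x', y', w'⟩ := P'
    simp only [mem_product] at hP hP'
    intro e
    obtain ⟨ex, ey, ew⟩ := htpp x hP.1 x' hP'.1 y hP.2.1 y' hP'.2.1 w hP.2.2 w' hP'.2.2 e
    exact hne (by rw [ex, ey, ew])
  -- `key P (key P')⁻¹ ∈ {1, z}`
  have hK : key P * (key P')⁻¹ = 1 ∨ key P * (key P')⁻¹ = z := by
    have lift : ∀ Q : G × G × G, key Q * z = g → key Q = g * z⁻¹ := fun Q e => by rw [← e]; group
    rcases hr with e | e <;> rcases hr' with e' | e'
    · left; rw [e, e']; group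
    · right; rw [e, lift _ e']
      calc g * (g * z⁻¹)⁻¹ = g * z * g⁻¹ := by group
        _ = z * g * g⁻¹ := by rw [h.central g]
        _ = z := by group
    · right; rw [lift _ e, e', h.inv_eq]
      calc g * z * g⁻¹ = z * g * g⁻¹ := by rw [h.central g]
        _ = z := by group
    · left; rw [lift _ e, lift _ e']; group
  obtain ⟨ζ, hζ, hKE⟩ := h.key_mul_inv_eq P P'
  rcases hζ with e | e <;> rw [e] at hKE <;> rcases hK with hK | hK <;> rw [hK] at hKE
  · exact absurd (by simpa using hKE.symm) hE1
  · simpa using hKE.symm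
  · calc E P P' = E P P' * z * z⁻¹ := by group
      _ = z := by rw [← hKE, one_mul, h.inv_eq]
  · have e' : E P P' * z = 1 * z := by rw [one_mul]; exact hKE.symm
    exact absurd (mul_right_cancel e') hE1

/-! ## The theorem -/

/-- **No two-`3`-set TPP triple beats `Σ d³`.**  In a finite group with `SmallComm z` (e.g. centre of index `4`), every TPP triple
`(S, T, U)` with `|T| ≤ 3` and `|U| ≤ 3` has `2·|S||T||U| ≤ 3·|G|`. [folklore] -/
theorem two_mul_volume_le [Fintype G] [DecidableEq G] {S T U : Finset G} (htpp : TripleProductProperty S T U) (hT : #T ≤ 3)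
    (hU : #U ≤ 3) : 2 * (#S * #T * #U) ≤ 3 * Fintype.card G := by
  classical
  set V : Finset (G × G × G) := S ×ˢ (T ×ˢ U) with hV
  have hcardV : #V = #S * #T * #U := by rw [hV, card_product, card_product, mul_assoc]
  let r : (G × G × G) → G → Prop := fun P g => key P = g ∨ key P * z = g
  have hL : ∀ P ∈ V, #((univ : Finset G).bipartiteAbove r P) = 2 := by
    intro P _
    have hset : (univ : Finset G).bipartiteAbove r P = {key P * z, key P} := by
      ext g
      simp only [bipartiteAbove, mem_filter, mem_univ, true_and, mem_insert, mem_singleton, r]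
      constructor
      · rintro (e | e); exacts [Or.inr e.symm, Or.inl e.symm]
      · rintro (e | e); exacts [Or.inr e.symm, Or.inl e.symm]
    rw [hset, card_insert_of_notMem, card_singleton]
    simp only [mem_singleton]
    intro e
    exact h.ne_one (by
      calc z = (key P)⁻¹ * (key P * z) := by group
        _ = 1 := by rw [e]; group)
  have hR : ∀ g ∈ (univ : Finset G), #(V.bipartiteBelow r g) ≤ 3 := by
    intro g _
    refine h.fibre_card_le_three hT hU (J := V.bipartiteBelow r g) ?_ ?_ ?_
    · intro P hP
      have := (mem_filter.1 hP).1; rw [hV, mem_product, mem_product] at this; exact this.2.1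
    · intro P hP
      have := (mem_filter.1 hP).1; rw [hV, mem_product, mem_product] at this; exact this.2.2
    · intro P hP P' hP' hne
      exact h.E_eq_of_fibre htpp (mem_filter.1 hP).1 (mem_filter.1 hP').1 hne (mem_filter.1 hP).2 (mem_filter.1 hP').2
  calc 2 * (#S * #T * #U) = ∑ P ∈ V, #((univ : Finset G).bipartiteAbove r P) := by
        rw [sum_const_nat hL, hcardV, mul_comm]
    _ = ∑ g ∈ (univ : Finset G), #(V.bipartiteBelow r g) := sum_card_bipartiteAbove_eq_sum_card_bipartiteBelow _
    _ ≤ ∑ g ∈ (univ : Finset G), 3 := sum_le_sum hR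
    _ = 3 * Fintype.card G := by rw [sum_const, card_univ, smul_eq_mul, mul_comm]

/-- **No `⟨N, m, p⟩` with `m, p ≤ 3` beyond `Σ d³`:** if `3|G| < 2Nmp` then `G` does not realize `⟨N, m, p⟩` (Cohn–Umans TPP). [folklore] -/
theorem not_realizesTPP [Fintype G] [DecidableEq G] {N m p : ℕ} (hm : m ≤ 3) (hp : p ≤ 3)
    (hlt : 3 * Fintype.card G < 2 * (N * m * p)) :
    ¬ Literature.Computability.AlgebraicComplexity.RealizesTPP G N m p := by
  rintro ⟨S, T, U, hS, hT, hU, htpp⟩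
  have := h.two_mul_volume_le (S := S) (T := T) (U := U) htpp (by omega) (by omega)
  rw [hS, hT, hU] at this
  omega

/-- **No `⟨N, 3, 3⟩` when `|G| < 6N`**, in every ordering of the sizes (`RealizesTPP.rotate`, Cohn–Umans 2003 Lemma 2.1). [folklore] -/
theorem not_realizesTPP_three_three [Fintype G] [DecidableEq G] (N : ℕ) (hlt : Fintype.card G < 6 * N) :
    ¬ Literature.Computability.AlgebraicComplexity.RealizesTPP G N 3 3 ∧
      ¬ Literature.Computability.AlgebraicComplexity.RealizesTPP G 3 N 3 ∧
        ¬ Literature.Computability.AlgebraicComplexity.RealizesTPP G 3 3 N := by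
  have h1 : ¬ Literature.Computability.AlgebraicComplexity.RealizesTPP G N 3 3 :=
    h.not_realizesTPP le_rfl le_rfl (by omega)
  exact ⟨h1, fun h' => h1 h'.rotate, fun h' => h1 h'.rotate.rotate⟩

end SmallComm

end Summit.MatrixMultiplication.OmegaCensus.CentreIndexFour
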